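import Summits.HodgeConjecture.HodgeConjecture.Theorems.MilnorKExponentialDefs
import Summits.HodgeConjecture.HodgeConjecture.Theorems.MilnorKExponentialSymbolClassesAlgebraicSymbolClassesHodgeType
import Summits.HodgeConjecture.HodgeConjecture.Theorems.MilnorKExponentialSymbolClassesAlgebraicNashSymbolConiveauOne

/-!
# `SymbolClassesAlgebraic` (stmt-HodgeConjecture-17743) · Negative · ceilings of the line `NashDescentSketch`

Negative knowledge for the crux `MilnorKExponential.SymbolClassesAlgebraic` (GK_p) about the lead's
picked line `NashDescentSketch` (skeleton v3, `Cruxes/SymbolClassesAlgebraic/Lines/NashDescentSketch.lean`),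
whose only sorries are the three BAND stubs (`1 ≤ q`, `q + 3 ≤ n`):

* (A-band) `stub_nashDescentBand` — every rational symbol class of weight `q + 1` is a Nash symbol class;
* (W₁-band) `stub_nashWeightTwoBandDiesOffClosed` — on an `n`-fold, `n ≥ 4`, a rational Nash symbol
  class of weight `2` dies on `(X ∖ Z)(ℂ)` for a proper Zariski-closed `Z`;
* (W_alg-band) `stub_nashHighBandAlgebraic` — rational Nash symbol classes of weight `3 ≤ q + 1 ≤ n - 2`
  are algebraic.

From the standing disprover's work file `Cruxes/SymbolClassesAlgebraic/Disproof.lean` (§9), companion of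
`Negative/Ceiling.lean` (the crux's own ceiling `¬ GK ⇒ ¬ HC`). Findings, all sorry-free:

* NECESSITY. The two weight stubs are CONSEQUENCES of the crux (a Nash symbol class is a symbol class,
  `IsNashSymbolClass.isSymbolClass`; `N² ⊆ N¹`): `not_symbolClassesAlgebraic_of_not_nashHighBand`,
  `not_symbolClassesAlgebraic_of_not_nashWeightTwoBand`. So a counterexample to either weight stub is a
  counterexample to the crux itself — the line cannot die at (W) while the crux survives. The descent
  stub (A) is a consequence of the crux GIVEN the Nash typing item `Alg ⊆ L_Nash`
  (`AlgebraicClassesAreNashSymbolClasses`): `not_symbolClassesAlgebraic_of_not_nashDescentBand`.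
* CEILING. Hence, through the crux's ceiling (the typing support `L ⊆ Hdg` is the landed
  `stub_symbolClassesHodgeType`), every stub sits below the Hodge conjecture:
  `not_hodgeConjecture_of_not_nashHighBand`, `not_hodgeConjecture_of_not_nashWeightTwoBand`,
  `not_hodgeConjecture_of_not_nashDescentBand` (the last modulo `Alg ⊆ L_Nash`). No stub of this line is
  refutable short of a counterexample to HC — except (A), and only through a failure of the NASH TYPING
  (`Alg ⊆ L_Nash` false: the Bloch–Quillen/Koszul cocycles of an algebraic cycle not expressible with
  `IsNashUnitOn` units and `nashMilnorRel` witnesses), which is therefore the line's cheapest falsifier.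
* SHAPE. The conclusion of (W₁-band) is consistent in the degenerate case: the zero class dies off the
  EMPTY closed set, which is proper because a smooth projective variety is non-empty
  (`nonempty_of_isSmoothProjective`, `dieOffClosed_zero`); the empty scheme, on which `Z ≠ univ` would be
  unsatisfiable, is excluded by `GeometricallyIrreducible`.
Refuter seat refuter-cdisprove-stmt-HodgeConjecture-17743-g2-0 (cdisprove gen 2, cycle 1), 2026-08-17.
-/

noncomputable section

-- The mandated namespace `Summit.<P>.<Sub>.Theorems.…` repeats `HodgeConjecture` (single-conjunct summit).
set_option linter.dupNamespace false

namespace Summit.HodgeConjecture.HodgeConjecture.Theorems.SymbolClassesAlgebraic.Negative.LineCeiling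

open CategoryTheory AlgebraicGeometry
open Literature.AlgebraicGeometry.HodgeTheory Literature.AlgebraicGeometry.Motives
open Summit.HodgeConjecture.HodgeConjecture.Theorems.MilnorKExponentialNash

/-! ### The weight stubs are consequences of the crux -/

/-- **(W_alg-band) follows from the crux**: a rational Nash symbol class is a rational symbol class
(`IsNashSymbolClass.isSymbolClass`), hence algebraic under GK (`gkNamed_of_route`). Contrapositive form:
a counterexample to the weight stub is a counterexample to the crux. [folklore] -/
theorem not_symbolClassesAlgebraic_of_not_nashHighBand
    (h : ¬ ∀ ⦃n : ℕ⦄ ⦃X : SchemeOver ℂ⦄, IsSmoothProjective n X → ∀ (q : ℕ), 2 ≤ q → q + 3 ≤ n →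
      ∀ (c : complexBetti X (2 * (q + 1))), IsRationalClass c → IsNashSymbolClass n X q c →
        c ∈ algebraicClasses X (q + 1)) :
    ¬ Theses.MilnorKExponential.SymbolClassesAlgebraic :=
  fun hGK ↦ h fun _ _ hX q _ _ c hc hN ↦ gkNamed_of_route hGK hX q c hc hN.isSymbolClass

/-- **(W₁-band) follows from the crux**: under GK a rational Nash symbol class of weight `2` is
algebraic, i.e. lies in `N² H⁴ ⊆ N¹ H⁴` (`supportedClasses_mono`), and a class of `N¹` dies off ONE
proper Zariski-closed subset (`exists_isClosed_ne_univ_of_mem_supportedClasses_one`). Contrapositive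
form. [cite: GrothendieckTopology1969, §1] -/
theorem not_symbolClassesAlgebraic_of_not_nashWeightTwoBand
    (h : ¬ ∀ ⦃n : ℕ⦄ ⦃X : SchemeOver ℂ⦄, IsSmoothProjective n X → 4 ≤ n →
      ∀ (c : complexBetti X (2 * (1 + 1))), IsRationalClass c → IsNashSymbolClass n X 1 c →
        ∃ Z : Set X.left, IsClosed Z ∧ Z ≠ Set.univ ∧
          complexBetti.restrictCompl X Z (2 * (1 + 1)) c = 0) :
    ¬ Theses.MilnorKExponential.SymbolClassesAlgebraic := by
  intro hGK
  refine h fun n X hX _ c hc hN ↦ ?_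
  have halg : c ∈ algebraicClasses X (1 + 1) := gkNamed_of_route hGK hX 1 c hc hN.isSymbolClass
  exact exists_isClosed_ne_univ_of_mem_supportedClasses_one hX
    (supportedClasses_mono X (2 * (1 + 1)) (Nat.le_succ 1) halg)

/-- **(A-band) follows from the crux given the Nash typing `Alg ⊆ L_Nash`** (the record
`nashDescent_of_gk`, restricted to the band). Contrapositive form: a counterexample to the descent stub
refutes the crux OR the Nash typing item — nothing else. [folklore] -/
theorem not_symbolClassesAlgebraic_of_not_nashDescentBand (hAlg : AlgebraicClassesAreNashSymbolClasses)
    (h : ¬ ∀ ⦃n : ℕ⦄ ⦃X : SchemeOver ℂ⦄, IsSmoothProjective n X → ∀ (q : ℕ), 1 ≤ q → q + 3 ≤ n →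
      ∀ (c : complexBetti X (2 * (q + 1))), IsRationalClass c → IsSymbolClass n X q c →
        IsNashSymbolClass n X q c) :
    ¬ Theses.MilnorKExponential.SymbolClassesAlgebraic :=
  fun hGK ↦ h fun _ _ hX q _ _ c hc hs ↦ hAlg hX q c hc (gkNamed_of_route hGK hX q c hc hs) hs

/-! ### Ceilings: every stub sits below the Hodge conjecture -/

/-- **`¬ (W_alg-band) ⇒ ¬ HC`**: a rational Nash symbol class is a rational symbol class, of Hodge type
`(q+1, q+1)` by the landed typing stub `stub_symbolClassesHodgeType` (`L ⊆ Hdg`), hence algebraic under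
the Hodge conjecture. [cite: Deligne2000, §1] -/
theorem not_hodgeConjecture_of_not_nashHighBand
    (h : ¬ ∀ ⦃n : ℕ⦄ ⦃X : SchemeOver ℂ⦄, IsSmoothProjective n X → ∀ (q : ℕ), 2 ≤ q → q + 3 ≤ n →
      ∀ (c : complexBetti X (2 * (q + 1))), IsRationalClass c → IsNashSymbolClass n X q c →
        c ∈ algebraicClasses X (q + 1)) :
    ¬ _root_.HodgeConjecture :=
  fun hHC ↦ h fun _ _ hX q _ _ c hc hN ↦
    (hHC hX).2 (q + 1) c hc (stub_symbolClassesHodgeType hX q c hc hN.isSymbolClass)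

/-- **`¬ (W₁-band) ⇒ ¬ HC`**: under the Hodge conjecture a rational Nash symbol class of weight `2` is
algebraic (typing stub `L ⊆ Hdg`), so it lies in `N² H⁴ ⊆ N¹ H⁴` and dies off one proper Zariski-closed
subset. [cite: Deligne2000, §1] [cite: GrothendieckTopology1969, §1] -/
theorem not_hodgeConjecture_of_not_nashWeightTwoBand
    (h : ¬ ∀ ⦃n : ℕ⦄ ⦃X : SchemeOver ℂ⦄, IsSmoothProjective n X → 4 ≤ n →
      ∀ (c : complexBetti X (2 * (1 + 1))), IsRationalClass c → IsNashSymbolClass n X 1 c →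
        ∃ Z : Set X.left, IsClosed Z ∧ Z ≠ Set.univ ∧
          complexBetti.restrictCompl X Z (2 * (1 + 1)) c = 0) :
    ¬ _root_.HodgeConjecture := by
  intro hHC
  refine h fun n X hX _ c hc hN ↦ ?_
  have halg : c ∈ algebraicClasses X (1 + 1) :=
    (hHC hX).2 (1 + 1) c hc (stub_symbolClassesHodgeType hX 1 c hc hN.isSymbolClass)
  exact exists_isClosed_ne_univ_of_mem_supportedClasses_one hX
    (supportedClasses_mono X (2 * (1 + 1)) (Nat.le_succ 1) halg)

/-- **`¬ (A-band) ⇒ ¬ HC`, modulo the Nash typing `Alg ⊆ L_Nash`**: under the Hodge conjecture a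
rational symbol class is algebraic (`L ⊆ Hdg`), hence a Nash symbol class by `Alg ⊆ L_Nash`. So the
descent stub can fail only with the Hodge conjecture or with the Nash typing item — the latter being
the line's one refutable typing test. [cite: Deligne2000, §1] -/
theorem not_hodgeConjecture_of_not_nashDescentBand (hAlg : AlgebraicClassesAreNashSymbolClasses)
    (h : ¬ ∀ ⦃n : ℕ⦄ ⦃X : SchemeOver ℂ⦄, IsSmoothProjective n X → ∀ (q : ℕ), 1 ≤ q → q + 3 ≤ n →
      ∀ (c : complexBetti X (2 * (q + 1))), IsRationalClass c → IsSymbolClass n X q c →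
        IsNashSymbolClass n X q c) :
    ¬ _root_.HodgeConjecture :=
  fun hHC ↦ h fun _ _ hX q _ _ c hc hs ↦
    hAlg hX q c hc ((hHC hX).2 (q + 1) c hc (stub_symbolClassesHodgeType hX q c hc hs)) hs

/-- The same ceiling for (A-band), packaged: its failure refutes the conjunction
`HodgeConjecture ∧ (Alg ⊆ L_Nash)`. [cite: Deligne2000, §1] -/
theorem not_hodgeConjecture_and_algNash_of_not_nashDescentBand
    (h : ¬ ∀ ⦃n : ℕ⦄ ⦃X : SchemeOver ℂ⦄, IsSmoothProjective n X → ∀ (q : ℕ), 1 ≤ q → q + 3 ≤ n →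
      ∀ (c : complexBetti X (2 * (q + 1))), IsRationalClass c → IsSymbolClass n X q c →
        IsNashSymbolClass n X q c) :
    ¬ (_root_.HodgeConjecture ∧ AlgebraicClassesAreNashSymbolClasses) :=
  fun hh ↦ not_hodgeConjecture_of_not_nashDescentBand hh.2 h hh.1

/-! ### Shape check of (W₁-band): the degenerate case is consistent -/

variable {n : ℕ} {X : SchemeOver ℂ}

/-- **A smooth projective variety is non-empty**: it is geometrically irreducible over the point
`Spec ℂ`, hence irreducible (Mathlib `GeometricallyIrreducible.irreducibleSpace_of_subsingleton`), and
irreducible spaces are non-empty. (So the empty scheme — smooth of every relative dimension, a closed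
subscheme of `ℙᴺ` — on which the clause `Z ≠ Set.univ` of (W₁-band) would be unsatisfiable, is NOT a
counterexample.) [cite: StacksProject, Tag 0366] -/
theorem nonempty_of_isSmoothProjective (hX : IsSmoothProjective n X) : Nonempty X.left := by
  haveI := hX.geometricallyIrreducible
  haveI : IrreducibleSpace X.left := GeometricallyIrreducible.irreducibleSpace_of_subsingleton X.hom
  infer_instance

/-- **The conclusion of (W₁-band) holds for the zero class**: `0` dies off the empty closed set, which
is a proper subset because `X` is non-empty. (Anti-triviality check of the shape `∃ Z, IsClosed Z ∧
Z ≠ univ ∧ c|_(X ∖ Z) = 0`: it is satisfiable, and only the class — not the geography of `X` — can make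
it fail.) [folklore] -/
theorem dieOffClosed_zero (hX : IsSmoothProjective n X) (i : ℕ) :
    ∃ Z : Set X.left, IsClosed Z ∧ Z ≠ Set.univ ∧
      complexBetti.restrictCompl X Z i (0 : complexBetti X i) = 0 := by
  obtain ⟨x⟩ := nonempty_of_isSmoothProjective hX
  exact ⟨∅, isClosed_empty, fun h ↦ (Set.ext_iff.1 h x).2 (Set.mem_univ x), map_zero _⟩

end Summit.HodgeConjecture.HodgeConjecture.Theorems.SymbolClassesAlgebraic.Negative.LineCeiling

end
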